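import Mathlib
import HarnessLib
import Summits.Ventures.LatticeQCDFlow.Exactness.IMHMultipleTryMinorisation
import Summits.Ventures.LatticeQCDFlow.Scaling.AutoregressiveGaugeAllClosingColdExact

/-!
# LatticeQCDFlow / Scaling — the MULTIPLE-TRY version of the exact all-closing conditioner (`A = Z/∏_ℓ c_{#C_ℓ}`): proposing `m + 1` gauge configurations per
# update, selecting one `∝` its importance weight and accepting it with the multiple-try ratio is EXACT for the Wilson law and converges from every start at
# rate at least `(m + 1)/(1/A + m)` per update — twice the ensemble (pool-selection) version's guaranteed batch efficiency

HONEST FRAMING: exact (Metropolis-corrected) sampling algorithms for lattice gauge theory;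
figures of merit are autocorrelation/cost numbers at stated couplings and volumes; no
continuum-physics claim.

Venture `LatticeQCDFlow` (cell pub-lqcd), topic `Scaling`, FANOUT row 30 (lean-1, GEN-42) — OUR WORK, the gauge instance of this generation's
abstract `Exactness/IMHMultipleTryExact` (the multiple-try rule with independent proposals is in detailed balance with `π = w·q` on a general state
space) and `Exactness/IMHMultipleTryMinorisation` (for a weight bounded by `W`, uniform ergodicity at rate `(m + 1)/(W + m)` from every start) for the
exact all-closing conditioner of `Scaling/AutoregressiveGaugeAllClosingColdExact`: plaquette weight `w` continuous, pinched `0 < m₀ ≤ w ≤ M₀`,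
inversion-symmetric; a link set `T` with disjoint covering plaquette families `C ℓ`; target `π` = the Wilson-type law `∏_p w(U_p)·Haar^{⊗E}/Z`;
proposal `q` = the all-closing conditioner's law; importance weight `dπ/dq = (Z/N(U))⁻¹` with `N(U) = ∏_{ℓ∈T} ∫ ∏_{p∈C ℓ} w(U[ℓ ↦ v]_p) dv`,
maximal at the cold configuration where it equals `1/A`, `A = Z/∏_ℓ c_{#C_ℓ}` (`c_k = ∫ w^k dHaar`) the displayed cold acceptance.  DEF-FREE: the
multiple-try kernel is any Markov kernel `P` satisfying the multiple-try equation of `IMHMultipleTryExact` for `q` and this weight with `m + 1` fresh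
proposals (select `J ∝` weight among the proposals, accept with `min(1, S_0/S_{J+1})`).  Twin of `Scaling/AutoregressiveGaugeHeatBathMultipleTry`;
compare GEN-41's `Scaling/AutoregressiveGaugeAllClosingMultiProposal` (pool selection).

* **`allClosing_multipleTry_invariant`** — `∫ P(U, B) π(dU) = π(B)`: THE MULTIPLE-TRY ALL-CLOSING SAMPLER IS EXACT FOR THE WILSON-TYPE LAW, for every
  batch size, lattice size `L ≥ 2`, dimension and compact group.
* **`allClosing_multipleTry_uniformlyErgodic`** — for every initial law `μ₀`, every `t` and every set `B`:
  `|μ₀Pᵗ(B) − π(B)| ≤ (1 − (m + 1)/(1/A + m))ᵗ` with `1/A = (∏_{ℓ∈T} c_{#C_ℓ})/Z`: batching `m + 1 ≈ 1/A` proposals per update halves the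
  distance to the Wilson-type law at every update (the pool-selection version needs `≈ 2/A`).
NOT CLAIMED: cost comparisons with `m + 1` single-proposal updates; any value of `A`.
No `def`, no `sorry`, nothing cited as a fact.
-/

noncomputable section

namespace Summit.Ventures.LatticeQCDFlow.Theory2.Autoregressive

open MeasureTheory ProbabilityTheory Function Finset
open scoped ENNReal
open Literature.MathematicalPhysics.QuantumFieldTheory Literature.MathematicalPhysics.QuantumLattice
open Summit.Ventures.LatticeQCDFlow.Exactness Summit.Ventures.LatticeQCDFlow.Scoring

variable {d L : ℕ} [NeZero L] {G : Type*} [Group G] [TopologicalSpace G] [IsTopologicalGroup G]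
  [CompactSpace G] [SecondCountableTopology G] [MeasurableSpace G] [BorelSpace G]

/-- **THE MULTIPLE-TRY ALL-CLOSING SAMPLER IS EXACT** (multiple try with `m + 1` fresh proposals of the exact all-closing conditioner; every compact
second-countable `G`, `L ≥ 2`): `∫ P(U, B) π(dU) = π(B)` for every measurable `B`. [ours] -/
theorem allClosing_multipleTry_invariant (hL : 2 ≤ L) {w : G → ℝ} (hw : Continuous w) {m₀ M₀ : ℝ} (hm0 : 0 < m₀)
    (hm : ∀ g, m₀ ≤ w g) (hM : ∀ g, w g ≤ M₀) (hwinv : ∀ g, w g⁻¹ = w g)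
    (T : Finset (Edge d L)) (C : Edge d L → Finset (Plaquette d L))
    (hCne : ∀ ℓ ∈ T, (C ℓ).Nonempty)
    (hCe : ∀ ℓ ∈ T, ∀ p ∈ C ℓ, ℓ ∈ ({(p.1, p.2.1.1), (p.1.shift p.2.1.1, p.2.1.2),
        (p.1.shift p.2.1.2, p.2.1.1), (p.1, p.2.1.2)} : Finset (Edge d L)))
    (hdisj : ∀ ℓ ∈ T, ∀ ℓ' ∈ T, ℓ ≠ ℓ' → Disjoint (C ℓ) (C ℓ'))
    (hcover : ∀ p : Plaquette d L, ∃ ℓ ∈ T, p ∈ C ℓ)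
    (π q : Measure (GaugeConfig d L G)) [IsProbabilityMeasure π] [IsProbabilityMeasure q]
    (hπ : π = (Measure.pi fun _ : Edge d L => haarProbability G).withDensity fun U =>
      ENNReal.ofReal ((∏ p : Plaquette d L, w (plaquetteHolonomy U p.1 p.2.1.1 p.2.1.2)) /
        ∫ V, ∏ p : Plaquette d L, w (plaquetteHolonomy V p.1 p.2.1.1 p.2.1.2) ∂(Measure.pi fun _ : Edge d L => haarProbability G)))
    (hq : q = (Measure.pi fun _ : Edge d L => haarProbability G).withDensity fun U =>
      ENNReal.ofReal (∏ ℓ ∈ T, (∏ p ∈ C ℓ, w (plaquetteHolonomy U p.1 p.2.1.1 p.2.1.2)) /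
          (∫ v, ∏ p ∈ C ℓ, w (plaquetteHolonomy (update U ℓ v) p.1 p.2.1.1 p.2.1.2) ∂(haarProbability G))))
    {m : ℕ} (P : Kernel (GaugeConfig d L G) (GaugeConfig d L G))
    (hP : ∀ (U : GaugeConfig d L G) {B : Set (GaugeConfig d L G)}, MeasurableSet B → P U B =
      ∫⁻ y, ∑ J : Fin (m + 1), ENNReal.ofReal ((fun U : GaugeConfig d L G =>
        (((∫ V, ∏ p : Plaquette d L, w (plaquetteHolonomy V p.1 p.2.1.1 p.2.1.2) ∂(Measure.pi fun _ : Edge d L => haarProbability G)) /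
          ∏ ℓ ∈ T, (∫ v, ∏ p ∈ C ℓ, w (plaquetteHolonomy (update U ℓ v) p.1 p.2.1.1 p.2.1.2) ∂(haarProbability G))))⁻¹)
          (Fin.cons (α := fun _ : Fin (m + 2) => GaugeConfig d L G) U y J.succ)) *
          B.indicator (fun _ => (1 : ℝ≥0∞)) (Fin.cons (α := fun _ : Fin (m + 2) => GaugeConfig d L G) U y J.succ) *
          min (∑ i ∈ Finset.univ.erase 0, ENNReal.ofReal ((fun U : GaugeConfig d L G =>
        (((∫ V, ∏ p : Plaquette d L, w (plaquetteHolonomy V p.1 p.2.1.1 p.2.1.2) ∂(Measure.pi fun _ : Edge d L => haarProbability G)) /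
          ∏ ℓ ∈ T, (∫ v, ∏ p ∈ C ℓ, w (plaquetteHolonomy (update U ℓ v) p.1 p.2.1.1 p.2.1.2) ∂(haarProbability G))))⁻¹)
          (Fin.cons (α := fun _ : Fin (m + 2) => GaugeConfig d L G) U y i)))⁻¹
            (∑ i ∈ Finset.univ.erase J.succ, ENNReal.ofReal ((fun U : GaugeConfig d L G =>
        (((∫ V, ∏ p : Plaquette d L, w (plaquetteHolonomy V p.1 p.2.1.1 p.2.1.2) ∂(Measure.pi fun _ : Edge d L => haarProbability G)) /
          ∏ ℓ ∈ T, (∫ v, ∏ p ∈ C ℓ, w (plaquetteHolonomy (update U ℓ v) p.1 p.2.1.1 p.2.1.2) ∂(haarProbability G))))⁻¹)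
          (Fin.cons (α := fun _ : Fin (m + 2) => GaugeConfig d L G) U y i)))⁻¹ ∂(Measure.pi fun _ : Fin (m + 1) => q) +
        (1 - ∫⁻ y, ∑ J : Fin (m + 1), ENNReal.ofReal ((fun U : GaugeConfig d L G =>
        (((∫ V, ∏ p : Plaquette d L, w (plaquetteHolonomy V p.1 p.2.1.1 p.2.1.2) ∂(Measure.pi fun _ : Edge d L => haarProbability G)) /
          ∏ ℓ ∈ T, (∫ v, ∏ p ∈ C ℓ, w (plaquetteHolonomy (update U ℓ v) p.1 p.2.1.1 p.2.1.2) ∂(haarProbability G))))⁻¹)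
          (Fin.cons (α := fun _ : Fin (m + 2) => GaugeConfig d L G) U y J.succ)) *
          min (∑ i ∈ Finset.univ.erase 0, ENNReal.ofReal ((fun U : GaugeConfig d L G =>
        (((∫ V, ∏ p : Plaquette d L, w (plaquetteHolonomy V p.1 p.2.1.1 p.2.1.2) ∂(Measure.pi fun _ : Edge d L => haarProbability G)) /
          ∏ ℓ ∈ T, (∫ v, ∏ p ∈ C ℓ, w (plaquetteHolonomy (update U ℓ v) p.1 p.2.1.1 p.2.1.2) ∂(haarProbability G))))⁻¹)
          (Fin.cons (α := fun _ : Fin (m + 2) => GaugeConfig d L G) U y i)))⁻¹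
            (∑ i ∈ Finset.univ.erase J.succ, ENNReal.ofReal ((fun U : GaugeConfig d L G =>
        (((∫ V, ∏ p : Plaquette d L, w (plaquetteHolonomy V p.1 p.2.1.1 p.2.1.2) ∂(Measure.pi fun _ : Edge d L => haarProbability G)) /
          ∏ ℓ ∈ T, (∫ v, ∏ p ∈ C ℓ, w (plaquetteHolonomy (update U ℓ v) p.1 p.2.1.1 p.2.1.2) ∂(haarProbability G))))⁻¹)
          (Fin.cons (α := fun _ : Fin (m + 2) => GaugeConfig d L G) U y i)))⁻¹ ∂(Measure.pi fun _ : Fin (m + 1) => q)) * B.indicator 1 U)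
    {B : Set (GaugeConfig d L G)} (hB : MeasurableSet B) :
    ∫⁻ U, P U B ∂π = π B := by
  obtain ⟨_, hρq, _, hρm, hρpos⟩ := allClosing_cold_acceptMass_eq hL hw hm0 hm hM hwinv T C hCne hCe hdisj hcover π q hπ hq
  set ρ : GaugeConfig d L G → ℝ := fun U =>
    ((∫ V, ∏ p : Plaquette d L, w (plaquetteHolonomy V p.1 p.2.1.1 p.2.1.2) ∂(Measure.pi fun _ : Edge d L => haarProbability G)) /
      ∏ ℓ ∈ T, (∫ v, ∏ p ∈ C ℓ, w (plaquetteHolonomy (update U ℓ v) p.1 p.2.1.1 p.2.1.2) ∂(haarProbability G))) with hρ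
  have hw0' : ∀ U, 0 < (ρ U)⁻¹ := fun U => inv_pos.2 (hρpos U)
  have hwm' : Measurable fun U => (ρ U)⁻¹ := hρm.inv
  have hπ' : (q.withDensity fun U => ENNReal.ofReal (ρ U)⁻¹) = π := withDensity_inv_density hρm hρpos hρq
  have h := mtm_invariant (q := q) (w := fun U => (ρ U)⁻¹) (n := m + 1) hwm' hw0' P hP hB
  rwa [hπ'] at h

/-- **BATCHING BUYS MIXING FOR THE EXACT GAUGE SAMPLER** (ensemble all-closing conditioner, `m + 1` fresh proposals per update): for every initial law
`μ₀`, every `t` and every set `B`, `|μ₀Pᵗ(B) − π(B)| ≤ (1 − (m + 1)/(1/A + m))ᵗ` with `1/A = (∏_{ℓ∈T} ∫ w^{#C_ℓ} dHaar)/Z` the cold importance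
weight (the reciprocal of the displayed cold acceptance). [ours] -/
theorem allClosing_multipleTry_uniformlyErgodic (hL : 2 ≤ L) {w : G → ℝ} (hw : Continuous w) {m₀ M₀ : ℝ} (hm0 : 0 < m₀)
    (hm : ∀ g, m₀ ≤ w g) (hM : ∀ g, w g ≤ M₀) (hwinv : ∀ g, w g⁻¹ = w g)
    (T : Finset (Edge d L)) (C : Edge d L → Finset (Plaquette d L))
    (hCne : ∀ ℓ ∈ T, (C ℓ).Nonempty)
    (hCe : ∀ ℓ ∈ T, ∀ p ∈ C ℓ, ℓ ∈ ({(p.1, p.2.1.1), (p.1.shift p.2.1.1, p.2.1.2),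
        (p.1.shift p.2.1.2, p.2.1.1), (p.1, p.2.1.2)} : Finset (Edge d L)))
    (hdisj : ∀ ℓ ∈ T, ∀ ℓ' ∈ T, ℓ ≠ ℓ' → Disjoint (C ℓ) (C ℓ'))
    (hcover : ∀ p : Plaquette d L, ∃ ℓ ∈ T, p ∈ C ℓ)
    (π q : Measure (GaugeConfig d L G)) [IsProbabilityMeasure π] [IsProbabilityMeasure q]
    (hπ : π = (Measure.pi fun _ : Edge d L => haarProbability G).withDensity fun U =>
      ENNReal.ofReal ((∏ p : Plaquette d L, w (plaquetteHolonomy U p.1 p.2.1.1 p.2.1.2)) /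
        ∫ V, ∏ p : Plaquette d L, w (plaquetteHolonomy V p.1 p.2.1.1 p.2.1.2) ∂(Measure.pi fun _ : Edge d L => haarProbability G)))
    (hq : q = (Measure.pi fun _ : Edge d L => haarProbability G).withDensity fun U =>
      ENNReal.ofReal (∏ ℓ ∈ T, (∏ p ∈ C ℓ, w (plaquetteHolonomy U p.1 p.2.1.1 p.2.1.2)) /
          (∫ v, ∏ p ∈ C ℓ, w (plaquetteHolonomy (update U ℓ v) p.1 p.2.1.1 p.2.1.2) ∂(haarProbability G))))
    {m : ℕ} (P : Kernel (GaugeConfig d L G) (GaugeConfig d L G))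
    (hP : ∀ (U : GaugeConfig d L G) {B : Set (GaugeConfig d L G)}, MeasurableSet B → P U B =
      ∫⁻ y, ∑ J : Fin (m + 1), ENNReal.ofReal ((fun U : GaugeConfig d L G =>
        (((∫ V, ∏ p : Plaquette d L, w (plaquetteHolonomy V p.1 p.2.1.1 p.2.1.2) ∂(Measure.pi fun _ : Edge d L => haarProbability G)) /
          ∏ ℓ ∈ T, (∫ v, ∏ p ∈ C ℓ, w (plaquetteHolonomy (update U ℓ v) p.1 p.2.1.1 p.2.1.2) ∂(haarProbability G))))⁻¹)
          (Fin.cons (α := fun _ : Fin (m + 2) => GaugeConfig d L G) U y J.succ)) *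
          B.indicator (fun _ => (1 : ℝ≥0∞)) (Fin.cons (α := fun _ : Fin (m + 2) => GaugeConfig d L G) U y J.succ) *
          min (∑ i ∈ Finset.univ.erase 0, ENNReal.ofReal ((fun U : GaugeConfig d L G =>
        (((∫ V, ∏ p : Plaquette d L, w (plaquetteHolonomy V p.1 p.2.1.1 p.2.1.2) ∂(Measure.pi fun _ : Edge d L => haarProbability G)) /
          ∏ ℓ ∈ T, (∫ v, ∏ p ∈ C ℓ, w (plaquetteHolonomy (update U ℓ v) p.1 p.2.1.1 p.2.1.2) ∂(haarProbability G))))⁻¹)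
          (Fin.cons (α := fun _ : Fin (m + 2) => GaugeConfig d L G) U y i)))⁻¹
            (∑ i ∈ Finset.univ.erase J.succ, ENNReal.ofReal ((fun U : GaugeConfig d L G =>
        (((∫ V, ∏ p : Plaquette d L, w (plaquetteHolonomy V p.1 p.2.1.1 p.2.1.2) ∂(Measure.pi fun _ : Edge d L => haarProbability G)) /
          ∏ ℓ ∈ T, (∫ v, ∏ p ∈ C ℓ, w (plaquetteHolonomy (update U ℓ v) p.1 p.2.1.1 p.2.1.2) ∂(haarProbability G))))⁻¹)
          (Fin.cons (α := fun _ : Fin (m + 2) => GaugeConfig d L G) U y i)))⁻¹ ∂(Measure.pi fun _ : Fin (m + 1) => q) +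
        (1 - ∫⁻ y, ∑ J : Fin (m + 1), ENNReal.ofReal ((fun U : GaugeConfig d L G =>
        (((∫ V, ∏ p : Plaquette d L, w (plaquetteHolonomy V p.1 p.2.1.1 p.2.1.2) ∂(Measure.pi fun _ : Edge d L => haarProbability G)) /
          ∏ ℓ ∈ T, (∫ v, ∏ p ∈ C ℓ, w (plaquetteHolonomy (update U ℓ v) p.1 p.2.1.1 p.2.1.2) ∂(haarProbability G))))⁻¹)
          (Fin.cons (α := fun _ : Fin (m + 2) => GaugeConfig d L G) U y J.succ)) *
          min (∑ i ∈ Finset.univ.erase 0, ENNReal.ofReal ((fun U : GaugeConfig d L G =>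
        (((∫ V, ∏ p : Plaquette d L, w (plaquetteHolonomy V p.1 p.2.1.1 p.2.1.2) ∂(Measure.pi fun _ : Edge d L => haarProbability G)) /
          ∏ ℓ ∈ T, (∫ v, ∏ p ∈ C ℓ, w (plaquetteHolonomy (update U ℓ v) p.1 p.2.1.1 p.2.1.2) ∂(haarProbability G))))⁻¹)
          (Fin.cons (α := fun _ : Fin (m + 2) => GaugeConfig d L G) U y i)))⁻¹
            (∑ i ∈ Finset.univ.erase J.succ, ENNReal.ofReal ((fun U : GaugeConfig d L G =>
        (((∫ V, ∏ p : Plaquette d L, w (plaquetteHolonomy V p.1 p.2.1.1 p.2.1.2) ∂(Measure.pi fun _ : Edge d L => haarProbability G)) /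
          ∏ ℓ ∈ T, (∫ v, ∏ p ∈ C ℓ, w (plaquetteHolonomy (update U ℓ v) p.1 p.2.1.1 p.2.1.2) ∂(haarProbability G))))⁻¹)
          (Fin.cons (α := fun _ : Fin (m + 2) => GaugeConfig d L G) U y i)))⁻¹ ∂(Measure.pi fun _ : Fin (m + 1) => q)) * B.indicator 1 U)
    (μ₀ : Measure (GaugeConfig d L G)) [IsProbabilityMeasure μ₀] (t : ℕ) (B : Set (GaugeConfig d L G)) :
    |((fun ν : Measure (GaugeConfig d L G) => ν.bind P)^[t] μ₀).real B - π.real B| ≤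
      (1 - (m + 1) / (((∏ ℓ ∈ T, ∫ h, w h ^ (C ℓ).card ∂(haarProbability G)) /
        (∫ V, ∏ p : Plaquette d L, w (plaquetteHolonomy V p.1 p.2.1.1 p.2.1.2) ∂(Measure.pi fun _ : Edge d L => haarProbability G))) + m)) ^ t := by
  obtain ⟨hA, hρq, hmax, hρm, hρpos⟩ := allClosing_cold_acceptMass_eq hL hw hm0 hm hM hwinv T C hCne hCe hdisj hcover π q hπ hq
  set cold : GaugeConfig d L G := fun _ => (1 : G) with hcold
  set ρ : GaugeConfig d L G → ℝ := fun U =>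
    ((∫ V, ∏ p : Plaquette d L, w (plaquetteHolonomy V p.1 p.2.1.1 p.2.1.2) ∂(Measure.pi fun _ : Edge d L => haarProbability G)) /
      ∏ ℓ ∈ T, (∫ v, ∏ p ∈ C ℓ, w (plaquetteHolonomy (update U ℓ v) p.1 p.2.1.1 p.2.1.2) ∂(haarProbability G))) with hρ
  have hw0' : ∀ U, 0 < (ρ U)⁻¹ := fun U => inv_pos.2 (hρpos U)
  have hwm' : Measurable fun U => (ρ U)⁻¹ := hρm.inv
  have hπ' : (q.withDensity fun U => ENNReal.ofReal (ρ U)⁻¹) = π := withDensity_inv_density hρm hρpos hρq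
  haveI : IsProbabilityMeasure (q.withDensity fun U => ENNReal.ofReal (ρ U)⁻¹) := by rw [hπ']; infer_instance
  -- `1/A`: the cold weight in closed form
  have hone : ∫⁻ y, ENNReal.ofReal (ρ y)⁻¹ ∂q = ENNReal.ofReal 1 := by
    have h : π Set.univ = 1 := measure_univ
    rw [← hπ', withDensity_apply _ MeasurableSet.univ, Measure.restrict_univ] at h
    rw [h, ENNReal.ofReal_one]
  have hA' := imhAcceptMass_toReal_eq_of_forall_le (q := q) hw0' cold hmax zero_le_one hone
  have hW : (ρ cold)⁻¹ = (∏ ℓ ∈ T, ∫ h, w h ^ (C ℓ).card ∂(haarProbability G)) /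
      (∫ V, ∏ p : Plaquette d L, w (plaquetteHolonomy V p.1 p.2.1.1 p.2.1.2) ∂(Measure.pi fun _ : Edge d L => haarProbability G)) := by
    have h1 : ((ρ cold)⁻¹)⁻¹ = (∫ V, ∏ p : Plaquette d L, w (plaquetteHolonomy V p.1 p.2.1.1 p.2.1.2) ∂(Measure.pi fun _ : Edge d L => haarProbability G)) /
        ∏ ℓ ∈ T, ∫ h, w h ^ (C ℓ).card ∂(haarProbability G) := by rw [← hA, hA', one_div]
    rw [← inv_inv (ρ cold)⁻¹, h1, inv_div]
  have h := mtm_uniformlyErgodic (q := q) (w := fun U => (ρ U)⁻¹) (m := m) hwm' hw0' (W := (ρ cold)⁻¹) hmax P hP μ₀ t B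
  rw [hπ', hW] at h
  exact h

end Summit.Ventures.LatticeQCDFlow.Theory2.Autoregressive
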